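import Summits.Ventures.YMGap.Thresholds.LatticeBakryEmeryWilson
import Summits.Ventures.YMGap.Thresholds.ExpWordCalculus
import Literature.MathematicalPhysics.QuantumFieldTheory.TorusPlaquetteNeighbours
import HarnessLib

/-!
# Venture YMGap — track (a), R119 brick, part 1/2: plaquette words with constant insertions and
# the Wilson cross-link interaction matrix `h(e,e') = N|β|·k(e,e')` (Shen–Zhu–Zhu (4.3)) — DEFINITIONS

HONEST FRAMING: venture file (cell `pub-ymgap`, track (a), seat ds-2 for lit-1's R119 line). Pure
finite-dimensional calculus + lattice counting; NO measure, NO threshold, NO clustering statement.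
Nothing about the continuum or the mass gap.

Bookkeeping for the termwise cross-link Hessian bound of the Wilson potential (part 2/2,
`SharpClusteringWilson.lean`): the four SLOTS of a torus plaquette (`plaqSlot`, the links of p2's
`plaqLinks` as a `Fin 4`-indexed family), the PLAQUETTE WORD WITH CONSTANT INSERTIONS
`W_p(c₁,c₂,c₃)(Q) = Re tr(Q_{s₀} c₁ Q_{s₁} c₂ Q_{s₂}ᴴ c₃ Q_{s₃}ᴴ)` (`plaqWordC`; `W_p(1,1,1)` is the
plaquette term of p2's `wilsonPot₀`, `wilsonPot₀_eq_sum_plaqWordC`; polynomial hence smooth; along the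
flow `Q e^{tA}` it is p2's `reTrWord`, `plaqWordC_mul_exp`), the slot incidence `slotInc p e`
(`= [e ∈ plaqEdgesT p]` once `L ≥ 2`, `slotInc_eq_ite`; `Σ_p slotInc p e · slotInc p e' = jointPlaq e e'`,
`sum_slotInc_mul_eq_jointPlaq`), and the CROSS-LINK INTERACTION MATRIX of the Wilson action at
't Hooft coupling `β` (tree coupling `Nβ`, the currency of p2's `wilsonPot d N L β` and
`hessBound_wilsonPot`):

  `wilsonH d N L β e e' = N|β| · jointPlaq e e'` if `e' ∈ linkNbrT e` (plaquette neighbours), else `0`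

— Shen–Zhu–Zhu's `h_{ee'} = N|β| · #{plaquettes ∋ e, e'}` of (4.3), in the tree's vocabulary
(`TorusPlaquetteNeighbours.lean`: `plaqEdgesT`, `plaqsThrough`, `linkNbrT`, `jointPlaq`). Proved here:
`h ≥ 0`, symmetric, zero on the diagonal, supported on plaquette neighbours, ROW SUMS
`Σ_{e'} h(e,e') ≤ 6(d-1)·N|β|` (`sum_wilsonH_le`, from the tree's `sum_jointPlaq_le`) — the
hypotheses `hh0 / hsymm / hrow` (`H = 6(d-1)N|β|`) of lit-1's `SharpClustering.Gam2W_ge`; the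
hypothesis `hOff` is part 2/2.

References: H. Shen, R. Zhu, X. Zhu, CMP 400 (2023) 805–851, Lemma 4.1, (4.3); E. Seiler, LNP 159
(1982) Ch. 2 (plaquettes through a link).
-/

noncomputable section

open scoped Matrix ComplexConjugate BigOperators Matrix.Norms.Frobenius ContDiff Topology
open Matrix Complex Finset
open Literature.MathematicalPhysics.QuantumFieldTheory
open Summit.Ventures.YMGap.HessianSharp (expWord reTrWord)

namespace Summit.Ventures.YMGap

namespace SharpClustering

open LatticeBakryEmery


/-! ### Words with two insertions at unitary points -/

section Words

variable {N : ℕ}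

/-- **Master bound**: `|Re tr(a M b M')| ≤ ‖a‖_F ‖b‖_F` for unitary `M, M'`. -/
theorem abs_re_trace_word_two_le {a b M M' : Matrix (Fin N) (Fin N) ℂ}
    (hM : M ∈ Matrix.unitaryGroup (Fin N) ℂ) (hM' : M' ∈ Matrix.unitaryGroup (Fin N) ℂ) :
    |(a * M * b * M').trace.re| ≤ frobNorm a * frobNorm b := by
  have h := abs_re_trace_mul_le a (M * b * M')
  rw [frobNorm_mul_unitary _ hM', frobNorm_unitary_mul hM] at h
  simpa only [Matrix.mul_assoc] using h

end Words

/-! ### Plaquette slots and the plaquette word with constant insertions -/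

section Slots

variable {d : ℕ} {L : ℕ}

/-- The four slots of a plaquette, in the order of `plaqLinks` / `plaquetteHolonomy`:
`s₀ = (x,i)`, `s₁ = (x+eᵢ,j)`, `s₂ = (x+eⱼ,i)`, `s₃ = (x,j)`. -/
def plaqSlot (p : Plaquette d L) : Fin 4 → Edge d L :=
  ![(plaqLinks p).1, (plaqLinks p).2.1, (plaqLinks p).2.2.1, (plaqLinks p).2.2.2]

/-- Slot `0` is `(x,i)`. -/
@[simp] theorem plaqSlot_zero (p : Plaquette d L) : plaqSlot p 0 = (plaqLinks p).1 := rfl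
/-- Slot `1` is `(x+eᵢ,j)`. -/
@[simp] theorem plaqSlot_one (p : Plaquette d L) : plaqSlot p 1 = (plaqLinks p).2.1 := rfl
/-- Slot `2` is `(x+eⱼ,i)`. -/
@[simp] theorem plaqSlot_two (p : Plaquette d L) : plaqSlot p 2 = (plaqLinks p).2.2.1 := rfl
/-- Slot `3` is `(x,j)`. -/
@[simp] theorem plaqSlot_three (p : Plaquette d L) : plaqSlot p 3 = (plaqLinks p).2.2.2 := rfl

end Slots

section Plaquette

variable {d N : ℕ} {L : ℕ}

/-- The **plaquette word with constant insertions**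
`W_p(c₁,c₂,c₃)(Q) = Re tr(Q_{s₀} c₁ Q_{s₁} c₂ Q_{s₂}ᴴ c₃ Q_{s₃}ᴴ)`; `W_p(1,1,1)` is the plaquette
term of `wilsonPot₀`. -/
def plaqWordC (p : Plaquette d L) (c₁ c₂ c₃ : Matrix (Fin N) (Fin N) ℂ) : Cfg (Edge d L) N → ℝ :=
  fun Q => (Q (plaqSlot p 0) * c₁ * Q (plaqSlot p 1) * c₂ * (Q (plaqSlot p 2))ᴴ * c₃ *
    (Q (plaqSlot p 3))ᴴ).trace.re

variable [NeZero L]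

/-- `wilsonPot₀ = Σ_p W_p(1,1,1)`. -/
theorem wilsonPot₀_eq_sum_plaqWordC :
    wilsonPot₀ d N L = fun Q => ∑ p : Plaquette d L, plaqWordC p 1 1 1 Q := by
  funext Q
  simp only [wilsonPot₀, plaqWordC, plaqSlot_zero, plaqSlot_one, plaqSlot_two, plaqSlot_three,
    Matrix.mul_one]

omit [NeZero L] in
/-- The plaquette word is a polynomial of degree `≤ 4`, hence smooth. -/
theorem plaqWordC_mem_polySpace (p : Plaquette d L) (c₁ c₂ c₃ : Matrix (Fin N) (Fin N) ℂ) :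
    plaqWordC (N := N) p c₁ c₂ c₃ ∈ polySpace (Edge d L) N 4 := by
  have hc : ∀ c : Matrix (Fin N) (Fin N) ℂ, IsCPolyMat (ι := Edge d L) (N := N) 0 fun _ => c :=
    fun c i j =>
      ⟨show (fun _ : Cfg (Edge d L) N => (c i j).re) ∈ _ from const_mem_polySpace 0 _,
       show (fun _ : Cfg (Edge d L) N => (c i j).im) ∈ _ from const_mem_polySpace 0 _⟩
  have h : IsCPolyMat (ι := Edge d L) (N := N) (1 + 0 + 1 + 0 + 1 + 0 + 1) fun Q =>
      Q (plaqSlot p 0) * c₁ * Q (plaqSlot p 1) * c₂ * (Q (plaqSlot p 2))ᴴ * c₃ * (Q (plaqSlot p 3))ᴴ :=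
    ((((((isCPolyMat_link _).mul (hc c₁)).mul (isCPolyMat_link _)).mul (hc c₂)).mul
      (isCPolyMat_link _).conjTranspose).mul (hc c₃)).mul (isCPolyMat_link _).conjTranspose
  exact h.re_trace_mem

/-- The plaquette word is smooth. -/
theorem contDiff_plaqWordC (p : Plaquette d L) (c₁ c₂ c₃ : Matrix (Fin N) (Fin N) ℂ) :
    ContDiff ℝ ∞ (plaqWordC (N := N) p c₁ c₂ c₃) :=
  contDiff_of_mem_polySpace (plaqWordC_mem_polySpace p c₁ c₂ c₃)

/-- Along the flow `t ↦ Q e^{tA}` the plaquette word is p2's `reTrWord` with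
`B₀ = Q_{s₀}, V₁ = A_{s₀}, B₁ = c₁Q_{s₁}, V₂ = A_{s₁}, B₂ = c₂, V₃ = A_{s₂}ᴴ, B₃ = Q_{s₂}ᴴc₃,
V₄ = A_{s₃}ᴴ, B₄ = Q_{s₃}ᴴ`. -/
theorem plaqWordC_mul_exp (p : Plaquette d L) (c₁ c₂ c₃ : Matrix (Fin N) (Fin N) ℂ)
    (Q A : Cfg (Edge d L) N) (t : ℝ) :
    plaqWordC p c₁ c₂ c₃ (Q * NormedSpace.exp (t • A)) =
      reTrWord (Q (plaqSlot p 0)) (A (plaqSlot p 0)) (c₁ * Q (plaqSlot p 1)) (A (plaqSlot p 1)) c₂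
        (A (plaqSlot p 2))ᴴ ((Q (plaqSlot p 2))ᴴ * c₃) (A (plaqSlot p 3))ᴴ ((Q (plaqSlot p 3))ᴴ) t := by
  have hlink : ∀ e : Edge d L, (Q * NormedSpace.exp (t • A)) e = Q e * NormedSpace.exp (t • A e) := by
    intro e
    rw [Pi.mul_apply, show NormedSpace.exp (t • A) = fun e => NormedSpace.exp ((t • A) e) from Pi.exp_def _]
    rfl
  have hct : ∀ e : Edge d L, (Q e * NormedSpace.exp (t • A e))ᴴ = NormedSpace.exp (t • (A e)ᴴ) * (Q e)ᴴ := by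
    intro e
    rw [Matrix.conjTranspose_mul, ← Matrix.exp_conjTranspose, Matrix.conjTranspose_smul]
    simp
  simp only [plaqWordC, reTrWord, expWord, hlink, hct, Matrix.mul_assoc]


end Plaquette

/-! ### Lattice bookkeeping: slots versus the tree's `plaqEdgesT` / `jointPlaq` / `linkNbrT` -/

section Lattice

variable {d : ℕ} {L : ℕ}

/-- The number of slots of `p` carrying the link `e` (`0` or `1` once `L ≥ 2`). -/
def slotInc (p : Plaquette d L) (e : Edge d L) : ℕ := (univ.filter fun j : Fin 4 => plaqSlot p j = e).card

/-- The tree's edge set of a plaquette is the set of its four slots. -/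
theorem mem_plaqEdgesT_iff_exists_slot {p : Plaquette d L} {e : Edge d L} :
    e ∈ plaqEdgesT p ↔ ∃ j, plaqSlot p j = e := by
  constructor
  · intro h
    simp only [plaqEdgesT, mem_insert, mem_singleton] at h
    rcases h with h | h | h | h
    · exact ⟨0, by rw [h]; rfl⟩
    · exact ⟨1, by rw [h]; rfl⟩
    · exact ⟨2, by rw [h]; rfl⟩
    · exact ⟨3, by rw [h]; rfl⟩
  · rintro ⟨j, rfl⟩
    fin_cases j <;> simp [plaqEdgesT, plaqSlot, plaqLinks]

/-- On a torus of side `L ≥ 2` the four slots of a plaquette are pairwise distinct. -/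
theorem plaqSlot_injective (hL : 1 < L) (p : Plaquette d L) : Function.Injective (plaqSlot p) := by
  haveI : Fact (1 < L) := ⟨hL⟩
  have h1 : (1 : ZMod L) ≠ 0 := one_ne_zero
  have hij : p.2.1.1 ≠ p.2.1.2 := p.2.2.ne
  have hshift : ∀ i : Fin d, p.1.shift i ≠ p.1 := fun i h => by
    have := congr_fun h i
    simp [Site.shift, h1] at this
  have h01 : plaqSlot p 0 ≠ plaqSlot p 1 := fun h => hij (congrArg Prod.snd h)
  have h03 : plaqSlot p 0 ≠ plaqSlot p 3 := fun h => hij (congrArg Prod.snd h)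
  have h12 : plaqSlot p 1 ≠ plaqSlot p 2 := fun h => hij (congrArg Prod.snd h).symm
  have h23 : plaqSlot p 2 ≠ plaqSlot p 3 := fun h => hij (congrArg Prod.snd h)
  have h02 : plaqSlot p 0 ≠ plaqSlot p 2 := fun h => hshift _ (congrArg Prod.fst h).symm
  have h13 : plaqSlot p 1 ≠ plaqSlot p 3 := fun h => hshift _ (congrArg Prod.fst h)
  intro a b hab
  fin_cases a <;> fin_cases b
  all_goals first
    | rfl
    | exact absurd hab h01 | exact absurd hab.symm h01 | exact absurd hab h02 | exact absurd hab.symm h02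
    | exact absurd hab h03 | exact absurd hab.symm h03 | exact absurd hab h12 | exact absurd hab.symm h12
    | exact absurd hab h13 | exact absurd hab.symm h13 | exact absurd hab h23 | exact absurd hab.symm h23

/-- For `L ≥ 2`: `slotInc p e = [e ∈ plaqEdgesT p]`. -/
theorem slotInc_eq_ite (hL : 1 < L) (p : Plaquette d L) (e : Edge d L) :
    slotInc p e = if e ∈ plaqEdgesT p then 1 else 0 := by
  classical
  by_cases h : e ∈ plaqEdgesT p
  · rw [if_pos h]
    obtain ⟨j, hj⟩ := mem_plaqEdgesT_iff_exists_slot.1 h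
    refine Finset.card_eq_one.2 ⟨j, ?_⟩
    ext k
    simp only [mem_filter, mem_univ, true_and, mem_singleton]
    rw [← hj]
    exact (plaqSlot_injective hL p).eq_iff
  · rw [if_neg h]
    refine Finset.card_eq_zero.2 (Finset.filter_eq_empty_iff.2 fun k _ hk => h ?_)
    exact mem_plaqEdgesT_iff_exists_slot.2 ⟨k, hk⟩

variable [NeZero L]

/-- `jointPlaq` counts the plaquettes containing both links. -/
theorem jointPlaq_eq_card_filter (x y : Edge d L) :
    jointPlaq x y = (univ.filter fun q : Plaquette d L => x ∈ plaqEdgesT q ∧ y ∈ plaqEdgesT q).card := by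
  rw [jointPlaq, plaqsThrough, Finset.filter_filter]

/-- The plaquette-neighbour relation is symmetric. -/
theorem mem_linkNbrT_comm {x y : Edge d L} : y ∈ linkNbrT x ↔ x ∈ linkNbrT y := by
  rw [mem_linkNbrT_iff, mem_linkNbrT_iff]
  exact ⟨fun ⟨h1, q, hq1, hq2⟩ => ⟨h1.symm, q, hq2, hq1⟩, fun ⟨h1, q, hq1, hq2⟩ => ⟨h1.symm, q, hq2, hq1⟩⟩

/-- Two distinct links that are not plaquette neighbours share no plaquette. -/
theorem jointPlaq_eq_zero_of_not_mem {x y : Edge d L} (hne : x ≠ y) (h : y ∉ linkNbrT x) :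
    jointPlaq x y = 0 := by
  rw [jointPlaq_eq_card_filter, Finset.card_eq_zero, Finset.filter_eq_empty_iff]
  intro q _ hq
  exact h (mem_linkNbrT_iff.2 ⟨hne.symm, q, hq.1, hq.2⟩)

/-- For `L ≥ 2`: `Σ_p slotInc p e · slotInc p e' = k(e,e')`. -/
theorem sum_slotInc_mul_eq_jointPlaq (hL : 1 < L) (e e' : Edge d L) :
    ∑ p : Plaquette d L, slotInc p e * slotInc p e' = jointPlaq e e' := by
  classical
  rw [jointPlaq_eq_card_filter, Finset.card_filter]
  refine sum_congr rfl fun p _ => ?_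
  rw [slotInc_eq_ite hL, slotInc_eq_ite hL]
  by_cases h1 : e ∈ plaqEdgesT p <;> by_cases h2 : e' ∈ plaqEdgesT p <;> simp [h1, h2]

/-! ### The Wilson cross-link Hessian matrix (Shen–Zhu–Zhu (4.3)) -/

/-- **The cross-link interaction matrix of the Wilson action** at 't Hooft coupling `β` (tree
coupling `Nβ`, the currency of p2's `wilsonPot d N L β`): `h(e,e') = N|β| · k(e,e')` for plaquette
neighbours `e' ∈ linkNbrT e` (`k(e,e') = jointPlaq e e'` = number of plaquettes containing both links,
i.e. with both `e, e'` among their four `plaqLinks`), and `0` otherwise (in particular on the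
diagonal). Shen–Zhu–Zhu CMP 400 (2023), (4.3): `h_{ee'} = N|β| · #{p : p ∋ e, e'}`. -/
def wilsonH (d N L : ℕ) [NeZero L] (β : ℝ) (e e' : Edge d L) : ℝ :=
  if e' ∈ linkNbrT e then (N : ℝ) * |β| * jointPlaq e e' else 0

variable (N : ℕ)

/-- `h ≥ 0`. -/
theorem wilsonH_nonneg (β : ℝ) (e e' : Edge d L) : 0 ≤ wilsonH d N L β e e' := by
  unfold wilsonH
  split_ifs
  · positivity
  · exact le_rfl

/-- `h` is symmetric. -/
theorem wilsonH_symm (β : ℝ) (e e' : Edge d L) : wilsonH d N L β e e' = wilsonH d N L β e' e := by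
  unfold wilsonH
  -- `k(e,e') = k(e',e)` (the tree's `StarKernel.jointPlaq_comm`, re-derived here to keep the import
  -- closure of the R119 line free of the DS star stack)
  have hj : jointPlaq e e' = jointPlaq e' e := by
    rw [jointPlaq_eq_card_filter, jointPlaq_eq_card_filter]
    congr 1
    exact Finset.filter_congr fun q _ => And.comm
  rw [hj]
  by_cases h : e' ∈ linkNbrT e
  · rw [if_pos h, if_pos (mem_linkNbrT_comm.1 h)]
  · rw [if_neg h, if_neg (fun h' => h (mem_linkNbrT_comm.1 h'))]

/-- `h` vanishes on the diagonal. -/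
theorem wilsonH_self (β : ℝ) (e : Edge d L) : wilsonH d N L β e e = 0 := by
  simp [wilsonH, not_mem_linkNbrT]

/-- `h(e,e') ≠ 0` only for plaquette neighbours (whose endpoints are within periodic sup-distance
`1`, `torusNorm_sub_le_one_of_mem_linkNbrT`). -/
theorem mem_linkNbrT_of_wilsonH_ne_zero {β : ℝ} {e e' : Edge d L} (h : wilsonH d N L β e e' ≠ 0) :
    e' ∈ linkNbrT e := by
  by_contra h'
  exact h (by simp [wilsonH, h'])

/-- **`h` in the form of lit-1's brick spec (W1)**: `h(e,e') = 0` if `e = e'`, else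
`N|β| · #{p : Plaquette d L | e, e' ∈ plaqEdgesT p}` (both links among the four `plaqLinks p`). -/
theorem wilsonH_eq_ite_card (β : ℝ) (e e' : Edge d L) :
    wilsonH d N L β e e' = if e = e' then 0 else
      (N : ℝ) * |β| * ((univ.filter fun q : Plaquette d L => e ∈ plaqEdgesT q ∧ e' ∈ plaqEdgesT q).card : ℕ) := by
  classical
  by_cases h : e = e'
  · subst h; rw [if_pos rfl, wilsonH_self]
  rw [if_neg h, ← jointPlaq_eq_card_filter]
  by_cases hn : e' ∈ linkNbrT e
  · rw [wilsonH, if_pos hn]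
  · rw [wilsonH, if_neg hn, jointPlaq_eq_zero_of_not_mem h hn, Nat.cast_zero, mul_zero]

/-- **Finite range**: `h(e,e') ≠ 0` only if some plaquette contains both links (both among its
four `plaqLinks`, i.e. in `plaqEdgesT p`; see also `mem_plaqEdgesT_iff_exists_slot`). -/
theorem exists_plaquette_of_wilsonH_ne_zero {β : ℝ} {e e' : Edge d L} (h : wilsonH d N L β e e' ≠ 0) :
    ∃ p : Plaquette d L, e ∈ plaqEdgesT p ∧ e' ∈ plaqEdgesT p :=
  ((mem_linkNbrT_iff.1 (mem_linkNbrT_of_wilsonH_ne_zero N h)).2)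

/-- **Row sums**: `Σ_{e'} h(e,e') ≤ 6(d-1) N|β|` for EVERY torus side `L ≥ 1` (the tree's double
counting `sum_jointPlaq_le`: `≤ 2(d-1)` plaquettes through a link, `≤ 3` other links each). -/
theorem sum_wilsonH_le (β : ℝ) (e : Edge d L) :
    ∑ e', wilsonH d N L β e e' ≤ 6 * ((d : ℝ) - 1) * N * |β| := by
  classical
  have h1 : ∑ e', wilsonH d N L β e e' = (N : ℝ) * |β| * ∑ e' ∈ linkNbrT e, (jointPlaq e e' : ℝ) := by
    simp only [wilsonH]
    rw [Finset.sum_ite_mem, Finset.univ_inter, Finset.mul_sum]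
  rw [h1]
  have h2 := sum_jointPlaq_le e
  have hd : ((6 * (d - 1 : ℕ) : ℕ) : ℝ) ≤ 6 * ((d : ℝ) - 1) := by
    rcases Nat.eq_zero_or_pos d with rfl | hd
    · exact e.2.elim0
    · push_cast [Nat.cast_sub hd]; exact le_rfl
  calc (N : ℝ) * |β| * ∑ e' ∈ linkNbrT e, (jointPlaq e e' : ℝ)
      ≤ (N : ℝ) * |β| * (6 * ((d : ℝ) - 1)) := by
        refine mul_le_mul_of_nonneg_left (h2.trans ?_) (by positivity)
        exact_mod_cast hd
    _ = 6 * ((d : ℝ) - 1) * N * |β| := by ring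

end Lattice

/-! ### Frobenius norms of the components of `single_e X` -/

section Single

variable {d N : ℕ} {L : ℕ}

/-- Frobenius norms of the components of `single_e X`. -/
theorem frobNorm_lk_apply (e s : Edge d L) (X : Matrix (Fin N) (Fin N) ℂ) :
    frobNorm (lk (ι := Edge d L) e X s) = if s = e then frobNorm X else 0 := by
  simp only [lk, Pi.single_apply]
  split_ifs
  · rfl
  · exact frobNorm_zero

/-- `Σ_j ‖(single_e X)_{s_j(p)}‖_F = slotInc p e · ‖X‖_F`. -/
theorem sum_frobNorm_lk_slots (p : Plaquette d L) (e : Edge d L) (X : Matrix (Fin N) (Fin N) ℂ) :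
    frobNorm (lk (ι := Edge d L) e X (plaqSlot p 0)) + frobNorm (lk (ι := Edge d L) e X (plaqSlot p 1)) +
        frobNorm (lk (ι := Edge d L) e X (plaqSlot p 2)) + frobNorm (lk (ι := Edge d L) e X (plaqSlot p 3)) =
      (slotInc p e : ℝ) * frobNorm X := by
  classical
  simp only [frobNorm_lk_apply]
  rw [slotInc, Finset.card_filter, Fin.sum_univ_four]
  push_cast
  split_ifs <;> ring

end Single

end SharpClustering

end Summit.Ventures.YMGap
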